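import Literature.Analysis.FunctionSpaces.DyadicSums
import HarnessLib

/-!
# The weighted paraproduct sums of Cheskidov–Shvydkoy's Lemma 3.2

Analysis/FunctionSpaces support file (serves the discharge of
`Literature.Analysis.FluidPDE.cheskidov_shvydkoy`, ns.S31). In the proof of Lemma 3.2
(arXiv:0708.3067, pp. 5–6) the nonlinear term of the block energy balance is split by Bony's
paraproduct formula into low–high, high–low and high–high interactions (`I`, `III`, `II`), each
bounded "using (6) and Young and Jensen's inequalities" by sums over pairs of dyadic indices with
geometric off-diagonal decay. This file isolates that bookkeeping as statements about nonnegative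
sequences on `ℤ` (in `ℝ≥0∞`, so that no summability hypotheses are needed), in the `H¹`-weighted
form used by the tree's proof (weights `4^j = λ_j²`):

* `a_l` (block `L²` norms), `s_l` (block `L^∞` norms), `g_l` (block gradient norms), a Bernstein
  scale `J`; hypotheses `s_l ≤ κ 2^l` for `l ≥ J` (smallness in `Ḃ^{-1}_{∞,∞}` at high frequencies),
  `∑_{l<J} s_l ≤ M`, the reverse Bernstein inequality `2^l a_l ≤ C_r g_l`, and `a_l ≤ A₀`;
* `paraT s l = ∑_{l' ≤ l-3} s_{l'}` (the low-frequency factor of the low–high terms), bounded by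
  `M + κ 2^{l-2}` (`paraT_le`); `paraQ2 s a j = ∑_{l ≥ j-4, |m| ≤ 2} s_l a_{l+m}` (the diagonal terms);
  `dyadicSqSum a = ∑_l (2^l a_l)²` (`≈ ‖∇v‖²₂` for `a_l = ‖Δ̇_l v‖₂`);
* the final bound `paraproduct_weighted_sum_le`:
  `∑_j 4^j g_j (2 ∑_{|m|≤2} a_{j+m} T_{j+m} + Q₂(j)) ≤ 40 M W(g)^{1/2} W(a)^{1/2} + 2570 κ C_r W(g)
   + 5 A₀ M 2^{J+4} W(g)^{1/2}` — linear in `W(g)` with the small factor `κ` (absorbed by viscosity),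
  and otherwise of Gronwall type (`W(g)^{1/2} W(a)^{1/2}`), which is what makes the `H¹` estimate close
  with constants independent of the `H¹` norm.

The tools are the shifted Cauchy–Schwarz and Schur bounds of `DyadicSums.lean` and explicit
geometric sums (`tsum_two_zpow_sub_nat`).

## References

* A. Cheskidov, R. Shvydkoy, Arch. Ration. Mech. Anal. 195 (2010) 159–169 = arXiv:0708.3067,
  proof of Lemma 3.2, pp. 5–6. [CheskidovShvydkoy2010]
* H. Bahouri, J.-Y. Chemin, R. Danchin, Fourier Analysis and Nonlinear PDE, Springer 2011, §2.6
  (Bony decomposition). [BahouriCheminDanchin2011]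
-/

noncomputable section

open Filter Topology Finset
open scoped ENNReal NNReal

namespace Literature.Analysis.FunctionSpaces

/-! ## Geometric sums over `ℤ` -/

/-- `2^k ≠ ∞` in `ℝ≥0∞`. [folklore] -/
theorem two_zpow_ne_top (k : ℤ) : (2 : ℝ≥0∞) ^ k ≠ ∞ := ENNReal.zpow_ne_top two_ne_zero ENNReal.ofNat_ne_top k

/-- `∑_{n ≥ 0} 2^{k - n} = 2^{k+1}` in `ℝ≥0∞` (`k ∈ ℤ`). [folklore] -/
theorem tsum_two_zpow_sub_nat (k : ℤ) : ∑' n : ℕ, (2 : ℝ≥0∞) ^ (k - n) = 2 ^ (k + 1) := by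
  have h2 : (2 : ℝ≥0∞) ≠ 0 := two_ne_zero
  have h2' : (2 : ℝ≥0∞) ≠ ∞ := ENNReal.ofNat_ne_top
  have : ∀ n : ℕ, (2 : ℝ≥0∞) ^ (k - n) = 2 ^ k * (2⁻¹) ^ n := fun n => by
    rw [ENNReal.zpow_sub h2 h2', zpow_natCast, ENNReal.inv_pow]
  simp_rw [this]
  rw [ENNReal.tsum_mul_left, ENNReal.tsum_geometric_two, ENNReal.zpow_add h2 h2', zpow_one]

/-- `∑_{n ≥ 0} 4^{k - n} ≤ 2 · 4^k`, written with `2^{2(k-n)}`: `∑_n 2^{2(k-n)} ≤ 2^{2k+1}`. [folklore] -/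
theorem tsum_four_zpow_sub_nat_le (k : ℤ) : ∑' n : ℕ, (2 : ℝ≥0∞) ^ (2 * (k - n)) ≤ 2 ^ (2 * k + 1) := by
  have h2 : (2 : ℝ≥0∞) ≠ 0 := two_ne_zero
  have h2' : (2 : ℝ≥0∞) ≠ ∞ := ENNReal.ofNat_ne_top
  have hle : ∀ n : ℕ, (2 : ℝ≥0∞) ^ (2 * (k - n)) ≤ 2 ^ (2 * k) * (2⁻¹) ^ n := by
    intro n
    rw [show 2 * (k - (n : ℤ)) = 2 * k - n - n by ring, ENNReal.zpow_sub h2 h2', ENNReal.zpow_sub h2 h2',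
      zpow_natCast, ENNReal.inv_pow, mul_assoc]
    refine mul_le_mul_right ?_ _
    calc (2 : ℝ≥0∞)⁻¹ ^ n * 2⁻¹ ^ n ≤ (2 : ℝ≥0∞)⁻¹ ^ n * 1 := by
          gcongr
          exact pow_le_one₀ (by simp) (by norm_num)
      _ = (2⁻¹) ^ n := mul_one _
  calc ∑' n : ℕ, (2 : ℝ≥0∞) ^ (2 * (k - n)) ≤ ∑' n : ℕ, 2 ^ (2 * k) * (2⁻¹) ^ n := ENNReal.tsum_le_tsum hle
    _ = 2 ^ (2 * k + 1) := by
        rw [ENNReal.tsum_mul_left, ENNReal.tsum_geometric_two, ENNReal.zpow_add h2 h2', zpow_one]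

/-! ## The low- and high-frequency parts of `T_l = ∑_{l' ≤ l-3} s_{l'}` -/

/-- The cumulative low-frequency sums `T_l = ∑_{n ≥ 0} s_{l-3-n} = ∑_{l' ≤ l - 3} s_{l'}`. [folklore] -/
def paraT (s : ℤ → ℝ≥0∞) (l : ℤ) : ℝ≥0∞ := ∑' n : ℕ, s (l - 3 - n)

/-- The sum of `s` over `{l < J}` as a sum over `ℕ`: `∑_l [l < J] s_l = ∑_n s_{J-1-n}`. [folklore] -/
theorem tsum_ite_lt_eq (s : ℤ → ℝ≥0∞) (J : ℤ) :
    ∑' l : ℤ, (if l < J then s l else 0) = ∑' n : ℕ, s (J - 1 - n) := by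
  have hsupp : ∀ l' : ℤ, l' ∉ Set.range (fun n : ℕ => J - 1 - (n : ℤ)) → (if l' < J then s l' else 0) = 0 := by
    intro l' hl'
    by_cases h : l' < J
    · exfalso; apply hl'
      refine ⟨(J - 1 - l').toNat, ?_⟩
      simp only
      rw [Int.toNat_of_nonneg (by omega)]
      ring
    · rw [if_neg h]
  rw [← tsum_subtype_eq_of_support_subset (s := Set.range (fun n : ℕ => J - 1 - (n : ℤ))) ?_]
  · rw [← Equiv.tsum_eq (Equiv.ofInjective (fun n : ℕ => J - 1 - (n : ℤ)) (fun a b hab => by simpa using hab))]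
    refine tsum_congr fun n => ?_
    simp only [Equiv.ofInjective_apply]
    rw [if_pos (by omega)]
  · intro l' hl'
    by_contra hc
    exact hl' (hsupp l' hc)

/-- **A low-frequency sub-sum is dominated by the total low-frequency sum**: along an injective
`φ : ℕ → ℤ`, `∑_n [φ n < J] s_{φ n} ≤ ∑_{l < J} s_l`. [folklore] -/
theorem tsum_comp_ite_lt_le (s : ℤ → ℝ≥0∞) (J : ℤ) {φ : ℕ → ℤ} (hφ : Function.Injective φ) :
    ∑' n : ℕ, (if φ n < J then s (φ n) else 0) ≤ ∑' n : ℕ, s (J - 1 - n) := by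
  rw [← tsum_ite_lt_eq]
  exact ENNReal.tsum_comp_le_tsum_of_injective hφ (fun l' => if l' < J then s l' else 0)

/-- **Bound on the cumulative sums**: if `s_{l'} ≤ κ 2^{l'}` for `l' ≥ J` and `∑_{l' < J} s_{l'} ≤ M`, then
`T_l ≤ M + κ 2^{l-2}` for every `l`. [folklore] -/
theorem paraT_le {s : ℤ → ℝ≥0∞} {J : ℤ} {κ M : ℝ≥0∞} (hs : ∀ l, J ≤ l → s l ≤ κ * 2 ^ l)
    (hM : ∑' n : ℕ, s (J - 1 - n) ≤ M) (l : ℤ) : paraT s l ≤ M + κ * 2 ^ (l - 2) := by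
  unfold paraT
  have hsplit : ∀ n : ℕ, s (l - 3 - n) ≤
      (if J ≤ l - 3 - n then κ * 2 ^ (l - 3 - (n : ℤ)) else 0) + (if l - 3 - n < J then s (l - 3 - n) else 0) := by
    intro n
    by_cases h : J ≤ l - 3 - n
    · rw [if_pos h, if_neg (not_lt.2 h), add_zero]; exact hs _ h
    · rw [if_neg h, if_pos (not_le.1 h), zero_add]
  refine (ENNReal.tsum_le_tsum hsplit).trans ?_
  rw [ENNReal.tsum_add, add_comm]
  refine add_le_add ?_ ?_
  · exact (tsum_comp_ite_lt_le s J (φ := fun n : ℕ => l - 3 - (n : ℤ)) (fun a b hab => by simpa using hab)).trans hM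
  · have h3 : ∀ n : ℕ, (if J ≤ l - 3 - (n : ℤ) then κ * 2 ^ (l - 3 - (n : ℤ)) else 0) ≤ κ * (2 : ℝ≥0∞) ^ (l - 3 - (n : ℤ)) :=
      fun n => by split_ifs <;> simp
    refine (ENNReal.tsum_le_tsum h3).trans ?_
    rw [ENNReal.tsum_mul_left]
    gcongr
    rw [tsum_two_zpow_sub_nat]
    exact (ENNReal.zpow_le_of_le (by norm_num) (by omega)).trans_eq rfl

/-! ## The weighted sums of the paraproduct estimate -/

/-- The dyadically weighted square sum `W(a) = ∑_l (2^l a_l)²` (the `Ḣ¹`-type energy of a block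
sequence; with `a_l = ‖Δ̇_l v‖₂` this is `≈ ‖∇v‖²₂`, with `a_l = ‖∇Δ̇_l v‖₂` it is `≈ ‖Δv‖²₂`). [folklore] -/
def dyadicSqSum (a : ℤ → ℝ≥0∞) : ℝ≥0∞ := ∑' l, ((2 : ℝ≥0∞) ^ l * a l) ^ 2

/-- Each weighted term is bounded by the square root of the weighted square sum. [folklore] -/
theorem two_zpow_mul_le_sqrt_dyadicSqSum (a : ℤ → ℝ≥0∞) (l : ℤ) :
    (2 : ℝ≥0∞) ^ l * a l ≤ dyadicSqSum a ^ (1 / 2 : ℝ) := by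
  have h : ((2 : ℝ≥0∞) ^ l * a l) ^ 2 ≤ dyadicSqSum a := ENNReal.le_tsum (f := fun l => ((2 : ℝ≥0∞) ^ l * a l) ^ 2) l
  calc (2 : ℝ≥0∞) ^ l * a l = ((((2 : ℝ≥0∞) ^ l * a l) ^ 2) ^ (1 / 2 : ℝ)) := by
        rw [← ENNReal.rpow_natCast, ← ENNReal.rpow_mul]; norm_num
    _ ≤ dyadicSqSum a ^ (1 / 2 : ℝ) := ENNReal.rpow_le_rpow h (by norm_num)

/-- **Shifted Cauchy–Schwarz with dyadic weights**: `∑_j 4^j g_j a_{j+m} ≤ 2^{-m} W(g)^{1/2} W(a)^{1/2}`. [folklore] -/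
theorem tsum_four_zpow_mul_mul_shift_le (g a : ℤ → ℝ≥0∞) (m : ℤ) :
    ∑' j, (2 : ℝ≥0∞) ^ (2 * j) * g j * a (j + m) ≤
      2 ^ (-m) * (dyadicSqSum g ^ (1 / 2 : ℝ) * dyadicSqSum a ^ (1 / 2 : ℝ)) := by
  have h2 : (2 : ℝ≥0∞) ≠ 0 := two_ne_zero
  have h2' : (2 : ℝ≥0∞) ≠ ∞ := ENNReal.ofNat_ne_top
  have heq : ∀ j, (2 : ℝ≥0∞) ^ (2 * j) * g j * a (j + m) =
      2 ^ (-m) * ((2 ^ j * g j) * (2 ^ (j + m) * a (j + m))) := by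
    intro j
    rw [show (2 : ℤ) * j = j + (-m) + (j + m) by ring, ENNReal.zpow_add h2 h2', ENNReal.zpow_add h2 h2']
    ring
  simp_rw [heq]
  rw [ENNReal.tsum_mul_left]
  gcongr
  exact tsum_mul_shift_le (fun j => 2 ^ j * g j) (fun j => 2 ^ j * a j) m

/-- **Shifted Cauchy–Schwarz for two gradient-type sequences**: `∑_j 4^j g_j h_{j+m} ≤ 2^{-m} W(g)^{1/2} W(h)^{1/2}`,
the special case used with `h = g`: `∑_j 4^j g_j g_{j+m} ≤ 2^{-m} W(g)`. [folklore] -/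
theorem tsum_four_zpow_mul_mul_shift_le_self (g : ℤ → ℝ≥0∞) (m : ℤ) :
    ∑' j, (2 : ℝ≥0∞) ^ (2 * j) * g j * g (j + m) ≤ 2 ^ (-m) * dyadicSqSum g := by
  refine (tsum_four_zpow_mul_mul_shift_le g g m).trans_eq ?_
  rw [← ENNReal.rpow_add_of_nonneg _ _ (by norm_num) (by norm_num)]
  norm_num

/-- `∑_{m=-2}^{2} 2^{-m} ≤ 20` in `ℝ≥0∞` (each term is at most `4`). [folklore] -/
theorem sum_Icc_two_zpow_neg_le : ∑ m ∈ Finset.Icc (-2 : ℤ) 2, (2 : ℝ≥0∞) ^ (-m) ≤ 20 := by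
  have hle : ∀ m ∈ Finset.Icc (-2 : ℤ) 2, (2 : ℝ≥0∞) ^ (-m) ≤ 4 := by
    intro m hm
    rw [Finset.mem_Icc] at hm
    calc (2 : ℝ≥0∞) ^ (-m) ≤ 2 ^ (2 : ℤ) := ENNReal.zpow_le_of_le (by norm_num) (by omega)
      _ = 4 := by rw [show (2 : ℤ) = (2 : ℕ) by rfl, zpow_natCast]; norm_num
  calc ∑ m ∈ Finset.Icc (-2 : ℤ) 2, (2 : ℝ≥0∞) ^ (-m) ≤ ∑ m ∈ Finset.Icc (-2 : ℤ) 2, (4 : ℝ≥0∞) :=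
        Finset.sum_le_sum hle
    _ = 20 := by
        rw [Finset.sum_const, Int.card_Icc, show Int.toNat (2 + 1 - -2) = 5 by decide]; norm_num

/-- **The low–high part of the paraproduct sum** (CS's terms `I` and `III`): with `T_l ≤ M + κ 2^{l-2}`
and the reverse Bernstein bound `2^l a_l ≤ C_r g_l`,
`∑_j 4^j g_j ∑_{|m| ≤ 2} a_{j+m} (M + κ 2^{j+m-2}) ≤ 20 M W(g)^{1/2} W(a)^{1/2} + 5 κ C_r W(g)`. [folklore] -/
theorem tsum_lowHigh_le (g a : ℤ → ℝ≥0∞) (M κ Cr : ℝ≥0∞) (hrev : ∀ l, (2 : ℝ≥0∞) ^ l * a l ≤ Cr * g l) :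
    ∑' j, (2 : ℝ≥0∞) ^ (2 * j) * g j * ∑ m ∈ Finset.Icc (-2 : ℤ) 2, a (j + m) * (M + κ * 2 ^ (j + m - 2)) ≤
      20 * (M * (dyadicSqSum g ^ (1 / 2 : ℝ) * dyadicSqSum a ^ (1 / 2 : ℝ))) + 5 * (κ * (Cr * dyadicSqSum g)) := by
  have h2 : (2 : ℝ≥0∞) ≠ 0 := two_ne_zero
  have h2' : (2 : ℝ≥0∞) ≠ ∞ := ENNReal.ofNat_ne_top
  -- expand and exchange the sums
  have hexp : ∀ j, (2 : ℝ≥0∞) ^ (2 * j) * g j * ∑ m ∈ Finset.Icc (-2 : ℤ) 2, a (j + m) * (M + κ * 2 ^ (j + m - 2)) =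
      ∑ m ∈ Finset.Icc (-2 : ℤ) 2, (M * (2 ^ (2 * j) * g j * a (j + m)) +
        κ * (2 ^ (2 * j) * g j * (a (j + m) * 2 ^ (j + m - 2)))) := by
    intro j
    rw [Finset.mul_sum]
    refine Finset.sum_congr rfl fun m _ => ?_
    ring
  simp_rw [hexp]
  rw [Summable.tsum_finsetSum (fun m _ => ENNReal.summable)]
  simp_rw [ENNReal.tsum_add, ENNReal.tsum_mul_left]
  rw [Finset.sum_add_distrib]
  refine add_le_add ?_ ?_
  · -- `M`-terms
    calc ∑ m ∈ Finset.Icc (-2 : ℤ) 2, M * ∑' j, (2 : ℝ≥0∞) ^ (2 * j) * g j * a (j + m)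
        ≤ ∑ m ∈ Finset.Icc (-2 : ℤ) 2, M * (2 ^ (-m) * (dyadicSqSum g ^ (1 / 2 : ℝ) * dyadicSqSum a ^ (1 / 2 : ℝ))) := by
          gcongr with m
          exact tsum_four_zpow_mul_mul_shift_le g a m
      _ = (∑ m ∈ Finset.Icc (-2 : ℤ) 2, (2 : ℝ≥0∞) ^ (-m)) * (M * (dyadicSqSum g ^ (1 / 2 : ℝ) * dyadicSqSum a ^ (1 / 2 : ℝ))) := by
          rw [Finset.sum_mul]; refine Finset.sum_congr rfl fun m _ => by ring
      _ ≤ 20 * (M * (dyadicSqSum g ^ (1 / 2 : ℝ) * dyadicSqSum a ^ (1 / 2 : ℝ))) := by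
          gcongr; exact sum_Icc_two_zpow_neg_le
  · -- `κ`-terms: `a_{j+m} 2^{j+m-2} ≤ (C_r/4) g_{j+m}`
    have hterm : ∀ m j, (2 : ℝ≥0∞) ^ (2 * j) * g j * (a (j + m) * 2 ^ (j + m - 2)) ≤
        4⁻¹ * (Cr * (2 ^ (2 * j) * g j * g (j + m))) := by
      intro m j
      have h1 : a (j + m) * (2 : ℝ≥0∞) ^ (j + m - 2) ≤ 4⁻¹ * (Cr * g (j + m)) := by
        rw [ENNReal.zpow_sub h2 h2', show ((2 : ℝ≥0∞) ^ (2 : ℤ)) = 4 by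
          rw [show (2 : ℤ) = (2 : ℕ) by rfl, zpow_natCast]; norm_num]
        calc a (j + m) * ((2 : ℝ≥0∞) ^ (j + m) * 4⁻¹) = 4⁻¹ * (2 ^ (j + m) * a (j + m)) := by ring
          _ ≤ 4⁻¹ * (Cr * g (j + m)) := mul_le_mul_right (hrev (j + m)) _
      calc (2 : ℝ≥0∞) ^ (2 * j) * g j * (a (j + m) * 2 ^ (j + m - 2))
          ≤ 2 ^ (2 * j) * g j * (4⁻¹ * (Cr * g (j + m))) := by gcongr
        _ = 4⁻¹ * (Cr * (2 ^ (2 * j) * g j * g (j + m))) := by ring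
    calc ∑ m ∈ Finset.Icc (-2 : ℤ) 2, κ * ∑' j, (2 : ℝ≥0∞) ^ (2 * j) * g j * (a (j + m) * 2 ^ (j + m - 2))
        ≤ ∑ m ∈ Finset.Icc (-2 : ℤ) 2, κ * ∑' j, 4⁻¹ * (Cr * (2 ^ (2 * j) * g j * g (j + m))) :=
          Finset.sum_le_sum fun m _ => mul_le_mul_right (ENNReal.tsum_le_tsum (hterm m)) _
      _ ≤ ∑ m ∈ Finset.Icc (-2 : ℤ) 2, κ * (4⁻¹ * (Cr * (2 ^ (-m) * dyadicSqSum g))) := by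
          gcongr with m
          rw [ENNReal.tsum_mul_left, ENNReal.tsum_mul_left]
          gcongr
          exact tsum_four_zpow_mul_mul_shift_le_self g m
      _ = (∑ m ∈ Finset.Icc (-2 : ℤ) 2, (2 : ℝ≥0∞) ^ (-m)) * (4⁻¹ * (κ * (Cr * dyadicSqSum g))) := by
          rw [Finset.sum_mul]; refine Finset.sum_congr rfl fun m _ => by ring
      _ ≤ 20 * (4⁻¹ * (κ * (Cr * dyadicSqSum g))) := by gcongr; exact sum_Icc_two_zpow_neg_le
      _ = 5 * (κ * (Cr * dyadicSqSum g)) := by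
          rw [← mul_assoc, show (20 : ℝ≥0∞) * 4⁻¹ = 5 by
            rw [show (20 : ℝ≥0∞) = 5 * 4 by norm_num, mul_assoc, ENNReal.mul_inv_cancel (by norm_num) (by norm_num), mul_one]]

/-- The diagonal (high–high) part of the paraproduct sum: `Q₂(j) = ∑_{l ≥ j-4} ∑_{|m| ≤ 2} s_l a_{l+m}`,
written with `l = j - 4 + n`. [folklore] -/
def paraQ2 (s a : ℤ → ℝ≥0∞) (j : ℤ) : ℝ≥0∞ :=
  ∑' n : ℕ, ∑ m ∈ Finset.Icc (-2 : ℤ) 2, s (j - 4 + n) * a (j - 4 + n + m)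

/-- `∑_{m=-2}^{2} 4^{-m} ≤ 80` in `ℝ≥0∞`, written with `2^{-2m}`. [folklore] -/
theorem sum_Icc_two_zpow_neg_two_mul_le : ∑ m ∈ Finset.Icc (-2 : ℤ) 2, (2 : ℝ≥0∞) ^ (-(2 * m)) ≤ 80 := by
  have hle : ∀ m ∈ Finset.Icc (-2 : ℤ) 2, (2 : ℝ≥0∞) ^ (-(2 * m)) ≤ 16 := by
    intro m hm
    rw [Finset.mem_Icc] at hm
    calc (2 : ℝ≥0∞) ^ (-(2 * m)) ≤ 2 ^ (4 : ℤ) := ENNReal.zpow_le_of_le (by norm_num) (by omega)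
      _ = 16 := by rw [show (4 : ℤ) = (4 : ℕ) by rfl, zpow_natCast]; norm_num
  calc ∑ m ∈ Finset.Icc (-2 : ℤ) 2, (2 : ℝ≥0∞) ^ (-(2 * m)) ≤ ∑ m ∈ Finset.Icc (-2 : ℤ) 2, (16 : ℝ≥0∞) :=
        Finset.sum_le_sum hle
    _ = 80 := by
        rw [Finset.sum_const, Int.card_Icc, show Int.toNat (2 + 1 - -2) = 5 by decide]; norm_num

/-- **The diagonal part of the paraproduct sum, high frequencies** (CS's term `II`): with
`s_l ≤ κ 2^l` at the frequencies entering and `2^l a_l ≤ C_r g_l`,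
`∑_j 4^j g_j ∑_{n, |m|≤2} κ 2^{j-4+n} a_{j-4+n+m} ≤ 2560 κ C_r W(g)` (Schur's bound with the geometric gain
`2^{j-l}` of the divergence form). [folklore] -/
theorem tsum_diag_high_le (g a : ℤ → ℝ≥0∞) (κ Cr : ℝ≥0∞) (hrev : ∀ l, (2 : ℝ≥0∞) ^ l * a l ≤ Cr * g l) :
    ∑' j, (2 : ℝ≥0∞) ^ (2 * j) * g j *
        ∑' n : ℕ, ∑ m ∈ Finset.Icc (-2 : ℤ) 2, κ * 2 ^ (j - 4 + n) * a (j - 4 + n + m) ≤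
      2560 * (κ * (Cr * dyadicSqSum g)) := by
  have h2 : (2 : ℝ≥0∞) ≠ 0 := two_ne_zero
  have h2' : (2 : ℝ≥0∞) ≠ ∞ := ENNReal.ofNat_ne_top
  -- termwise: `4^j g_j κ 2^{j-4+n} a_{j-4+n+m} ≤ κ C_r 2^{-m} 4^j g_j g_{j+(n-4+m)}`
  have hterm : ∀ j (n : ℕ) m, (2 : ℝ≥0∞) ^ (2 * j) * g j * (κ * 2 ^ (j - 4 + n) * a (j - 4 + n + m)) ≤
      κ * (Cr * (2 ^ (-m) * (2 ^ (2 * j) * g j * g (j + ((n : ℤ) - 4 + m))))) := by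
    intro j n m
    have h1 : (2 : ℝ≥0∞) ^ (j - 4 + n) * a (j - 4 + n + m) ≤ 2 ^ (-m) * (Cr * g (j - 4 + n + m)) := by
      have := hrev (j - 4 + n + m)
      calc (2 : ℝ≥0∞) ^ (j - 4 + n) * a (j - 4 + n + m)
          = 2 ^ (-m) * (2 ^ (j - 4 + n + m) * a (j - 4 + n + m)) := by
            rw [← mul_assoc, ← ENNReal.zpow_add h2 h2']; congr 2; ring
        _ ≤ 2 ^ (-m) * (Cr * g (j - 4 + n + m)) := mul_le_mul_right this _
    calc (2 : ℝ≥0∞) ^ (2 * j) * g j * (κ * 2 ^ (j - 4 + n) * a (j - 4 + n + m))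
        = κ * (2 ^ (2 * j) * g j * (2 ^ (j - 4 + n) * a (j - 4 + n + m))) := by ring
      _ ≤ κ * (2 ^ (2 * j) * g j * (2 ^ (-m) * (Cr * g (j - 4 + n + m)))) := by gcongr
      _ = κ * (Cr * (2 ^ (-m) * (2 ^ (2 * j) * g j * g (j + ((n : ℤ) - 4 + m))))) := by
          rw [show j - 4 + (n : ℤ) + m = j + ((n : ℤ) - 4 + m) by ring]; ring
  -- pull the finite sum and the `n`-sum out
  have hexp : ∀ j, (2 : ℝ≥0∞) ^ (2 * j) * g j *
      ∑' n : ℕ, ∑ m ∈ Finset.Icc (-2 : ℤ) 2, κ * 2 ^ (j - 4 + n) * a (j - 4 + n + m) =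
      ∑' n : ℕ, ∑ m ∈ Finset.Icc (-2 : ℤ) 2, (2 : ℝ≥0∞) ^ (2 * j) * g j * (κ * 2 ^ (j - 4 + n) * a (j - 4 + n + m)) := by
    intro j
    rw [← ENNReal.tsum_mul_left]
    refine tsum_congr fun n => ?_
    rw [Finset.mul_sum]
  simp_rw [hexp]
  rw [ENNReal.tsum_comm]
  calc ∑' n : ℕ, ∑' j, ∑ m ∈ Finset.Icc (-2 : ℤ) 2, (2 : ℝ≥0∞) ^ (2 * j) * g j * (κ * 2 ^ (j - 4 + n) * a (j - 4 + n + m))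
      ≤ ∑' n : ℕ, ∑' j, ∑ m ∈ Finset.Icc (-2 : ℤ) 2,
          κ * (Cr * (2 ^ (-m) * (2 ^ (2 * j) * g j * g (j + ((n : ℤ) - 4 + m))))) :=
        ENNReal.tsum_le_tsum fun n => ENNReal.tsum_le_tsum fun j => Finset.sum_le_sum fun m _ => hterm j n m
    _ = ∑' n : ℕ, ∑ m ∈ Finset.Icc (-2 : ℤ) 2, κ * (Cr * (2 ^ (-m) *
          ∑' j, (2 : ℝ≥0∞) ^ (2 * j) * g j * g (j + ((n : ℤ) - 4 + m)))) := by
        refine tsum_congr fun n => ?_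
        rw [Summable.tsum_finsetSum (fun m _ => ENNReal.summable)]
        refine Finset.sum_congr rfl fun m _ => ?_
        rw [ENNReal.tsum_mul_left, ENNReal.tsum_mul_left, ENNReal.tsum_mul_left]
    _ ≤ ∑' n : ℕ, ∑ m ∈ Finset.Icc (-2 : ℤ) 2, κ * (Cr * (2 ^ (-m) * (2 ^ (-((n : ℤ) - 4 + m)) * dyadicSqSum g))) := by
        gcongr with n m
        exact tsum_four_zpow_mul_mul_shift_le_self g _
    _ = (∑' n : ℕ, (2 : ℝ≥0∞) ^ ((4 : ℤ) - n)) * ((∑ m ∈ Finset.Icc (-2 : ℤ) 2, (2 : ℝ≥0∞) ^ (-(2 * m))) *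
          (κ * (Cr * dyadicSqSum g))) := by
        rw [← ENNReal.tsum_mul_right]
        refine tsum_congr fun n => ?_
        rw [Finset.sum_mul, Finset.mul_sum]
        refine Finset.sum_congr rfl fun m _ => ?_
        have : (2 : ℝ≥0∞) ^ (-m) * 2 ^ (-((n : ℤ) - 4 + m)) = 2 ^ ((4 : ℤ) - n) * 2 ^ (-(2 * m)) := by
          rw [← ENNReal.zpow_add h2 h2', ← ENNReal.zpow_add h2 h2']; congr 1; ring
        calc κ * (Cr * (2 ^ (-m) * (2 ^ (-((n : ℤ) - 4 + m)) * dyadicSqSum g)))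
            = (2 ^ (-m) * 2 ^ (-((n : ℤ) - 4 + m))) * (κ * (Cr * dyadicSqSum g)) := by ring
          _ = 2 ^ ((4 : ℤ) - n) * (2 ^ (-(2 * m)) * (κ * (Cr * dyadicSqSum g))) := by rw [this]; ring
    _ ≤ 2 ^ ((4 : ℤ) + 1) * (80 * (κ * (Cr * dyadicSqSum g))) := by
        rw [tsum_two_zpow_sub_nat]
        gcongr
        exact sum_Icc_two_zpow_neg_two_mul_le
    _ = 2560 * (κ * (Cr * dyadicSqSum g)) := by
        rw [← mul_assoc, show (2 : ℝ≥0∞) ^ ((4 : ℤ) + 1) * 80 = 2560 by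
          rw [show (4 : ℤ) + 1 = (5 : ℕ) by rfl, zpow_natCast]; norm_num]

/-- `∑_{j ≤ k} 2^j = 2^{k+1}` as an indicator sum over `ℤ`. [folklore] -/
theorem tsum_ite_le_two_zpow (k : ℤ) : ∑' j : ℤ, (if j < k + 1 then (2 : ℝ≥0∞) ^ j else 0) = 2 ^ (k + 1) := by
  rw [tsum_ite_lt_eq (fun j => (2 : ℝ≥0∞) ^ j) (k + 1)]
  simp_rw [show ∀ n : ℕ, k + 1 - 1 - (n : ℤ) = k - n from fun n => by ring]
  exact tsum_two_zpow_sub_nat k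

/-- **The diagonal part of the paraproduct sum, low frequencies** (the part of CS's `II` below the
Bernstein scale `J`, where only `∑_{l<J} s_l ≤ M` and `a_l ≤ A₀` are used):
`∑_j 4^j g_j ∑_{n,|m|≤2} [j-4+n < J] s_{j-4+n} a_{j-4+n+m} ≤ 5 A₀ M 2^{J+4} W(g)^{1/2}`. [folklore] -/
theorem tsum_diag_low_le (g a s : ℤ → ℝ≥0∞) (J : ℤ) (M A₀ : ℝ≥0∞) (hM : ∑' n : ℕ, s (J - 1 - n) ≤ M)
    (ha : ∀ l, a l ≤ A₀) :
    ∑' j, (2 : ℝ≥0∞) ^ (2 * j) * g j *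
        ∑' n : ℕ, ∑ m ∈ Finset.Icc (-2 : ℤ) 2,
          (if j - 4 + (n : ℤ) < J then s (j - 4 + n) else 0) * a (j - 4 + n + m) ≤
      5 * (A₀ * (M * (2 ^ (J + 4) * dyadicSqSum g ^ (1 / 2 : ℝ)))) := by
  have h2 : (2 : ℝ≥0∞) ≠ 0 := two_ne_zero
  have h2' : (2 : ℝ≥0∞) ≠ ∞ := ENNReal.ofNat_ne_top
  -- the inner sums: `≤ 5 A₀ M` if `j ≤ J + 3`, and `0` otherwise
  have hinner : ∀ j, ∑' n : ℕ, ∑ m ∈ Finset.Icc (-2 : ℤ) 2,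
      (if j - 4 + (n : ℤ) < J then s (j - 4 + n) else 0) * a (j - 4 + n + m) ≤
      if j < J + 4 then 5 * (A₀ * M) else 0 := by
    intro j
    by_cases hj : j < J + 4
    · rw [if_pos hj]
      calc ∑' n : ℕ, ∑ m ∈ Finset.Icc (-2 : ℤ) 2, (if j - 4 + (n : ℤ) < J then s (j - 4 + n) else 0) * a (j - 4 + n + m)
          ≤ ∑' n : ℕ, ∑ m ∈ Finset.Icc (-2 : ℤ) 2, (if j - 4 + (n : ℤ) < J then s (j - 4 + n) else 0) * A₀ := by
            gcongr with n m; exact ha _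
        _ = 5 * (A₀ * ∑' n : ℕ, (if j - 4 + (n : ℤ) < J then s (j - 4 + n) else 0)) := by
            simp_rw [Finset.sum_const, Int.card_Icc, show Int.toNat (2 + 1 - -2) = 5 by decide]
            rw [← ENNReal.tsum_mul_left, ← ENNReal.tsum_mul_left]
            refine tsum_congr fun n => ?_
            rw [nsmul_eq_mul]; push_cast; ring
        _ ≤ 5 * (A₀ * M) := by
            gcongr
            exact (tsum_comp_ite_lt_le s J (φ := fun n : ℕ => j - 4 + (n : ℤ))
              (fun a b hab => by simpa using hab)).trans hM
    · rw [if_neg hj]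
      refine le_of_eq (ENNReal.tsum_eq_zero.2 fun n => Finset.sum_eq_zero fun m _ => ?_)
      rw [if_neg (by omega), zero_mul]
  calc ∑' j, (2 : ℝ≥0∞) ^ (2 * j) * g j * ∑' n : ℕ, ∑ m ∈ Finset.Icc (-2 : ℤ) 2,
          (if j - 4 + (n : ℤ) < J then s (j - 4 + n) else 0) * a (j - 4 + n + m)
      ≤ ∑' j, (2 : ℝ≥0∞) ^ (2 * j) * g j * (if j < J + 4 then 5 * (A₀ * M) else 0) := by
        gcongr with j; exact hinner j
    _ ≤ ∑' j, (if j < J + 3 + 1 then (2 : ℝ≥0∞) ^ j else 0) * (dyadicSqSum g ^ (1 / 2 : ℝ) * (5 * (A₀ * M))) := by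
        refine ENNReal.tsum_le_tsum fun j => ?_
        rw [show J + 3 + 1 = J + 4 by ring]
        split_ifs with hj
        · have hw := two_zpow_mul_le_sqrt_dyadicSqSum g j
          calc (2 : ℝ≥0∞) ^ (2 * j) * g j * (5 * (A₀ * M)) = 2 ^ j * (2 ^ j * g j) * (5 * (A₀ * M)) := by
                rw [show (2 : ℤ) * j = j + j by ring, ENNReal.zpow_add h2 h2', mul_assoc (2 ^ j)]
            _ ≤ 2 ^ j * dyadicSqSum g ^ (1 / 2 : ℝ) * (5 * (A₀ * M)) := by gcongr
            _ = _ := by ring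
        · simp
    _ = 2 ^ (J + 4) * (dyadicSqSum g ^ (1 / 2 : ℝ) * (5 * (A₀ * M))) := by
        rw [ENNReal.tsum_mul_right, tsum_ite_le_two_zpow, show J + 3 + 1 = J + 4 by ring]
    _ = 5 * (A₀ * (M * (2 ^ (J + 4) * dyadicSqSum g ^ (1 / 2 : ℝ)))) := by ring

/-- **The weighted paraproduct sum** (the summation behind Cheskidov–Shvydkoy's bounds on `I, II, III`,
arXiv:0708.3067 pp. 5–6, in the `H¹`-weighted form used here). Let `a, s, g ≥ 0` on `ℤ` (block `L²` norms,
block `L^∞` norms, block gradient norms), `J ∈ ℤ`, and assume: `s_l ≤ κ 2^l` for `l ≥ J` (smallness in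
`B^{-1}_{∞,∞}` beyond `J`), `∑_{l<J} s_l ≤ M` (Bernstein below `J`), `2^l a_l ≤ C_r g_l` (reverse Bernstein)
and `a_l ≤ A₀`. Then
`∑_j 4^j g_j (2 ∑_{|m|≤2} a_{j+m} T_{j+m} + Q₂(j)) ≤ 40 M W(g)^{1/2}W(a)^{1/2} + 2570 κ C_r W(g) + 5 A₀ M 2^{J+4} W(g)^{1/2}`
with `T = paraT s`, `Q₂ = paraQ2 s a`, `W = dyadicSqSum`. [folklore] -/
theorem paraproduct_weighted_sum_le (a s g : ℤ → ℝ≥0∞) (J : ℤ) (κ M Cr A₀ : ℝ≥0∞)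
    (hs : ∀ l, J ≤ l → s l ≤ κ * 2 ^ l) (hM : ∑' n : ℕ, s (J - 1 - n) ≤ M)
    (hrev : ∀ l, (2 : ℝ≥0∞) ^ l * a l ≤ Cr * g l) (ha : ∀ l, a l ≤ A₀) :
    ∑' j, (2 : ℝ≥0∞) ^ (2 * j) * g j *
        (2 * ∑ m ∈ Finset.Icc (-2 : ℤ) 2, a (j + m) * paraT s (j + m) + paraQ2 s a j) ≤
      40 * (M * (dyadicSqSum g ^ (1 / 2 : ℝ) * dyadicSqSum a ^ (1 / 2 : ℝ))) + 2570 * (κ * (Cr * dyadicSqSum g)) +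
        5 * (A₀ * (M * (2 ^ (J + 4) * dyadicSqSum g ^ (1 / 2 : ℝ)))) := by
  -- the low–high part through `paraT_le`
  have hLH : ∑' j, (2 : ℝ≥0∞) ^ (2 * j) * g j * (2 * ∑ m ∈ Finset.Icc (-2 : ℤ) 2, a (j + m) * paraT s (j + m)) ≤
      2 * (20 * (M * (dyadicSqSum g ^ (1 / 2 : ℝ) * dyadicSqSum a ^ (1 / 2 : ℝ))) + 5 * (κ * (Cr * dyadicSqSum g))) := by
    calc ∑' j, (2 : ℝ≥0∞) ^ (2 * j) * g j * (2 * ∑ m ∈ Finset.Icc (-2 : ℤ) 2, a (j + m) * paraT s (j + m))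
        = 2 * ∑' j, (2 : ℝ≥0∞) ^ (2 * j) * g j * ∑ m ∈ Finset.Icc (-2 : ℤ) 2, a (j + m) * paraT s (j + m) := by
          rw [← ENNReal.tsum_mul_left]; exact tsum_congr fun j => by ring
      _ ≤ 2 * ∑' j, (2 : ℝ≥0∞) ^ (2 * j) * g j *
            ∑ m ∈ Finset.Icc (-2 : ℤ) 2, a (j + m) * (M + κ * 2 ^ (j + m - 2)) := by
          gcongr with j m; exact paraT_le hs hM _
      _ ≤ _ := by gcongr; exact tsum_lowHigh_le g a M κ Cr hrev
  -- the diagonal part, split at `J`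
  have hsplit : ∀ l, s l ≤ κ * 2 ^ l + (if l < J then s l else 0) := by
    intro l
    by_cases h : l < J
    · rw [if_pos h]; exact le_add_self
    · rw [if_neg h, add_zero]; exact hs l (not_lt.1 h)
  have hD : ∑' j, (2 : ℝ≥0∞) ^ (2 * j) * g j * paraQ2 s a j ≤
      2560 * (κ * (Cr * dyadicSqSum g)) + 5 * (A₀ * (M * (2 ^ (J + 4) * dyadicSqSum g ^ (1 / 2 : ℝ)))) := by
    calc ∑' j, (2 : ℝ≥0∞) ^ (2 * j) * g j * paraQ2 s a j
        ≤ ∑' j, (2 : ℝ≥0∞) ^ (2 * j) * g j *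
            ((∑' n : ℕ, ∑ m ∈ Finset.Icc (-2 : ℤ) 2, κ * 2 ^ (j - 4 + n) * a (j - 4 + n + m)) +
             ∑' n : ℕ, ∑ m ∈ Finset.Icc (-2 : ℤ) 2,
               (if j - 4 + (n : ℤ) < J then s (j - 4 + n) else 0) * a (j - 4 + n + m)) := by
          refine ENNReal.tsum_le_tsum fun j => mul_le_mul_right ?_ _
          unfold paraQ2
          rw [← ENNReal.tsum_add]
          refine ENNReal.tsum_le_tsum fun n => ?_
          rw [← Finset.sum_add_distrib]
          refine Finset.sum_le_sum fun m _ => ?_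
          rw [← add_mul]
          exact mul_le_mul_left (hsplit _) _
      _ = (∑' j, (2 : ℝ≥0∞) ^ (2 * j) * g j *
            ∑' n : ℕ, ∑ m ∈ Finset.Icc (-2 : ℤ) 2, κ * 2 ^ (j - 4 + n) * a (j - 4 + n + m)) +
          ∑' j, (2 : ℝ≥0∞) ^ (2 * j) * g j * ∑' n : ℕ, ∑ m ∈ Finset.Icc (-2 : ℤ) 2,
               (if j - 4 + (n : ℤ) < J then s (j - 4 + n) else 0) * a (j - 4 + n + m) := by
          rw [← ENNReal.tsum_add]; exact tsum_congr fun j => by rw [mul_add]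
      _ ≤ _ := add_le_add (tsum_diag_high_le g a κ Cr hrev) (tsum_diag_low_le g a s J M A₀ hM ha)
  have hexp : ∀ j, (2 : ℝ≥0∞) ^ (2 * j) * g j *
      (2 * ∑ m ∈ Finset.Icc (-2 : ℤ) 2, a (j + m) * paraT s (j + m) + paraQ2 s a j) =
      (2 : ℝ≥0∞) ^ (2 * j) * g j * (2 * ∑ m ∈ Finset.Icc (-2 : ℤ) 2, a (j + m) * paraT s (j + m)) +
        (2 : ℝ≥0∞) ^ (2 * j) * g j * paraQ2 s a j := fun j => by rw [mul_add]
  simp_rw [hexp]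
  rw [ENNReal.tsum_add]
  calc _ ≤ 2 * (20 * (M * (dyadicSqSum g ^ (1 / 2 : ℝ) * dyadicSqSum a ^ (1 / 2 : ℝ))) + 5 * (κ * (Cr * dyadicSqSum g))) +
        (2560 * (κ * (Cr * dyadicSqSum g)) + 5 * (A₀ * (M * (2 ^ (J + 4) * dyadicSqSum g ^ (1 / 2 : ℝ))))) :=
        add_le_add hLH hD
    _ = _ := by ring

end Literature.Analysis.FunctionSpaces

end
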